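/-
Copyright (c) 2026 the pub-hodgecm-mathlib formalisation cell (harness21).  Prover seat hodgecm-mathlib-K2E2-p12 (g4): Track B «K2-LIT», ENGINE E1,
h413 = stmt-HodgeConjecture-24833; FILE 3 of K2E1-plan (g4)'s «R7₂-SCALAR» (2026-09-04T06:53:00Z), part (3b): the `U(J₂)` intertwining scalar `c(σ)` as a
LINE INTEGRAL over `(L⁺ ⊗ ℝ) × 𝔸_{L⁺,f}`, split into archimedean and finite factors, canonically normalised, with both factors integrable for `σ > 1`.
-/
import Summits.HodgeConjecture.HodgeConjecture.Theorems.K2E1IntertwinedCoeffContinuousCMTwo    -- ★ `integrable_borelHeight_weylLongU_mul_rpow_cm_two` (Godement at CM, [D8]₂ chain)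
import Summits.HodgeConjecture.HodgeConjecture.Theorems.K2E1HeightBigCellLineFormulaU2        -- ★ p857981 `coe_borelHeight_weylLongU_line_mul_eq_cm_two` (the height along the line)
import Summits.HodgeConjecture.HodgeConjecture.Theorems.K2E1UnipotentHaarNormalisationU2       -- ★ `isInvInvariant_of_isHaarMeasure_two` (+ ★ `UnitaryGroupLineHaarNormalisationTwo`: the `𝔸_F`-reading)
import Literature.NumberTheory.Automorphic.AdelicFundamentalDomain                             -- ★ `adeleFundamentalDomain = D_∞ × 𝒪̂`, `measurableSet_adeleFundamentalDomain`
import Literature.NumberTheory.Automorphic.AdeleRingTopology                                   -- ★ `infiniteAdeleRingHomeomorph : K_∞ ≃ₜ mixedSpace K` (= `ringEquiv_mixedSpace`)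
import Literature.NumberTheory.Automorphic.AdicCompletionCompact                               -- ★ `locallyCompactSpace_adeleRing'`, `locallyCompactSpace_finiteAdeleRing'`
import HarnessLib

/-!
# K2·E1 — `K2E1IntertwiningScalarLineIntegralU2` (FILE 3, part (3b)): THE `U(J₂)` INTERTWINING SCALAR AS A LINE INTEGRAL —
# `c_ν(σ)∕ν(𝓕) = (μ_E(D_∞)·μ_f(𝒪̂))⁻¹ · ∫_{L⁺⊗ℝ} A(s)^{−σ} dμ_E · ∫_{𝔸_{L⁺,f}} h_f(b)^{−σ} dμ_f`, canonically normalised; both factors in `L¹` for `σ > 1`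

Track B ∕ K2-LIT, crux h413 = `stmt-HodgeConjecture-24833`, route of record `HCCMUnconditional`; cell `hodgecm-mathlib`, squad K2, ENGINE E1 (campaign «EIS-RANK-ONE», R7₂ FILE 3).
Dealer K2E1-plan (g4) 06:53:00Z («every normalisation EXPLICIT (`ν(𝓕_N) = 1 ↔ μ_F`-volumes)»).  THEOREMS ONLY (no `def`, no instance, no notation, no named-fact hypothesis, no
`sorry`; default heartbeats); lane `--supports stmt-HodgeConjecture-24833 --as helper` (count-neutral).  CM pair `L/L⁺`, `c = complexConj`, `N = 2`, `δ ∈ L⁻ ∖ 0`.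

THE MATHEMATICS [MoeglinWaldspurger1995, II.1.6; Garrett2018, §2.8; Rogawski1990, §1.10, Prop. 7.3.1; TateThesis1967, Thm 4.1.3].  `c_ν(σ) := ∫_{N(𝔸)} H(w₀ v)^σ dν(v)` is ★ [D8]₂'s
scalar (`∫ H(w₀ v g)^σ dν = c_ν(σ)·H(g)^{1−σ}`).  Along the chart `Φ(s, b) = n(θ(ι⁻¹ s, b))` — `ι⁻¹ : L⁺ ⊗ ℝ ≅ (L⁺)_∞` (Mathlib `ringEquiv_mixedSpace`), `θ : 𝔸_{L⁺} ≅ 𝔸_L⁻` (★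
`traceZeroLine`), `n : 𝔸_L⁻ ≅ N(𝔸)` (★ `middleRootUnipotent`) — the height is EXPLICIT (★ p857981): `H(w₀·Φ(s,b)) = (A(s)·h_f(b))⁻¹`, `A(s) = ∏_{w∣∞ of L}(1 + (wδ)²s_{w|L⁺}²)`,
`h_f(b) = ∏ᶠ_w max(1, ‖θ(0,b)_w‖)`.  §1: so `H(w₀·Φ(s,b))^σ = A(s)^{−σ}·h_f(b)^{−σ}`.  §2: for ANY Haar `ν` of `N(𝔸)` and ANY fundamental domain `𝓕` of `N(L⁺)`, ★
`inv_mul_integral_eq_inv_mul_integral_traceZeroLine_two` (the `𝔸_F`-reading, at the additive Haar measure `ψ_*(μ_E × μ_f)` of `𝔸_{L⁺}`, `ψ(s,b) = (ι⁻¹ s, b)`) and Tate's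
`ψ⁻¹(D_{L⁺}) = D_∞ × 𝒪̂` give the CANONICALLY NORMALISED line integral
**`ν(𝓕)⁻¹·c_ν(σ) = (μ_E(D_∞)·μ_f(𝒪̂))⁻¹ · (∫ A^{−σ} dμ_E) · (∫ h_f^{−σ} dμ_f)`** (Mathlib `integral_prod_mul`; no integrability needed, both sides carry the same Bochner junk).
§3: for `σ > 1`, ★ `integrable_borelHeight_weylLongU_mul_rpow_cm_two` (Godement at CM) at `g = 1` for the transported Haar `Φ_*(μ_E × μ_f)` (its binders discharged: ★
`isInvInvariant_of_isHaarMeasure_two`, ★ `isFundamentalDomain_image_traceZeroFundamentalDomain_two`, ★ `exists_isCompact_image_traceZeroFundamentalDomain_subset_two`) and Fubini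
(`integrable_prod_iff`) give **`h_f^{−σ} ∈ L¹(μ_f)`** and **`A^{−σ} ∈ L¹(μ_E)`**.  FILE 3 proper (`K2E1IntertwiningScalarEulerProductU2`) turns `μ_f(𝒪̂)⁻¹·∫ h_f^{−σ} dμ_f` into the Euler
product `(∏_{v∈S} a_v(σ))·ζ^S_{L⁺}(2σ−1)∕ζ^S_{L⁺}(2σ)` (★ (3a) `AdelicProductIntegralOne` + ★ (b1)–(b3) + ★ FILE 2 (a) + ★ FILE 1).
HONEST LABEL: HC_CM is proved only modulo the 7 printed citations (2 remaining named inputs: hLiu418 = `stmt-HodgeConjecture-24832`, h413 = `stmt-HodgeConjecture-24833`) until rung 0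
closes; this file asserts no named fact and closes no socket; count-neutral.

## References
* [MoeglinWaldspurger1995] C. Mœglin, J.-L. Waldspurger, *Spectral Decomposition and Eisenstein Series* (1995), II.1.6.
* [Garrett2018] P. Garrett, *Modern Analysis of Automorphic Forms by Example* (2018), §2.8.
* [Rogawski1990] J. D. Rogawski, *Automorphic Representations of Unitary Groups in Three Variables* (1990), §1.10, Prop. 7.3.1.
* [TateThesis1967] J. Tate, *Fourier analysis in number fields and Hecke's zeta-functions*, in Cassels–Fröhlich (1967), Thm 4.1.3, Lemma 4.1.4.
* [Godement1964] R. Godement, *Domaines fondamentaux des groupes arithmétiques*, Sém. Bourbaki 257 (1964), §1.1.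
-/

set_option autoImplicit false
set_option linter.dupNamespace false -- the mandated namespace repeats `HodgeConjecture.HodgeConjecture`

noncomputable section

open MeasureTheory Measure NumberField NumberField.InfinitePlace NumberField.mixedEmbedding IsDedekindDomain Set Filter
open scoped ENNReal NNReal Classical
open Literature.NumberTheory.Automorphic Literature.NumberTheory.Automorphic.UnitaryGroup AdelicGroupData
open Summit.HodgeConjecture.HodgeConjecture.Cruxes.H413
open Summit.HodgeConjecture.HodgeConjecture.Cruxes.H413.K2E1HeightBigCellLineFormulaU2 (coe_borelHeight_weylLongU_line_mul_eq_cm_two one_le_coe_finprod_line_cm_two)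
open Summit.HodgeConjecture.HodgeConjecture.Cruxes.H413.K2E1IntertwinedCoeffContinuousCMTwo (integrable_borelHeight_weylLongU_mul_rpow_cm_two)
open Summit.HodgeConjecture.HodgeConjecture.Cruxes.H413.K2E1UnipotentHaarNormalisationU2 (isInvInvariant_of_isHaarMeasure_two)

namespace Summit.HodgeConjecture.HodgeConjecture.Cruxes.H413.K2E1IntertwiningScalarLineIntegralU2

variable (L : Type) [Field L] [NumberField L] [IsCMField L]
  (hij : (((0 : Fin 2) : ℕ)) + 1 = ((1 : Fin 2) : ℕ)) (hN : 2 = 2 * ((0 : Fin 2) : ℕ) + 2)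
  {δ : L} (hcδ : IsCMField.complexConj L δ = -δ) (hδ : δ ≠ 0)

/-! ## §1 The integrand along the line: `H(w₀·n(θ(ι⁻¹ s, b)))^σ = A(s)^{−σ} · h_f(b)^{−σ}` -/

omit [IsCMField L] in
/-- `0 < A(s) = ∏_{w∣∞}(1 + (wδ)²·s_w²)`. [folklore] -/
theorem archFactor_pos (s : mixedSpace ↥(maximalRealSubfield L)) : 0 < (∏ w : InfinitePlace L, ((1 : ℝ) + (w δ) ^ 2 * (s.1 ⟨w.comap (algebraMap ↥(maximalRealSubfield L) L), K2E1HeightBigCellLineFormulaU2.isReal_comap_maximalRealSubfield L w⟩) ^ 2)) :=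
  Finset.prod_pos fun w _ => by positivity

/-- **`H(w₀·n(θ(ι⁻¹ s, b)))^σ = A(s)^{−σ} · h_f(b)^{−σ}`** for every real `σ` (★ p857981's line formula at `k = 1`, then `((A·h_f)⁻¹)^σ = A^{−σ}·h_f^{−σ}`, both factors `≥ 0`).
[cite: MoeglinWaldspurger1995, II.1.6] [cite: Garrett2018, §2.8] -/
theorem borelHeight_weylLongU_line_rpow_eq_cm_two (σ : ℝ) (s : mixedSpace ↥(maximalRealSubfield L)) (b : FiniteAdeleRing (𝓞 ↥(maximalRealSubfield L)) ↥(maximalRealSubfield L)) :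
    (borelHeight (((quasiSplit (↥(maximalRealSubfield L)) L (IsCMField.complexConj L) 2).toAdelic (weylLongU ((IsCMField.complexConj L : L ≃ₐ[↥(maximalRealSubfield L)] L) : L →+* L) (rfl : ((StdForm.antidiagonal 2).over L) = ((StdForm.antidiagonal 2).over L)))) * ((middleRootUnipotent hij hN (Multiplicative.ofAdd (traceZeroLine ↥(maximalRealSubfield L) L (IsCMField.complexConj L) hcδ hδ (((InfiniteAdeleRing.ringEquiv_mixedSpace ↥(maximalRealSubfield L)).symm s, b) : AdeleRing (𝓞 ↥(maximalRealSubfield L)) ↥(maximalRealSubfield L)))) : ↥(adelicUnipotent (↥(maximalRealSubfield L)) L (IsCMField.complexConj L) 2)) : (quasiSplit (↥(maximalRealSubfield L)) L (IsCMField.complexConj L) 2).Adelic)) : ℝ) ^ σ = (∏ w : InfinitePlace L, ((1 : ℝ) + (w δ) ^ 2 * (s.1 ⟨w.comap (algebraMap ↥(maximalRealSubfield L) L), K2E1HeightBigCellLineFormulaU2.isReal_comap_maximalRealSubfield L w⟩) ^ 2)) ^ (-σ) * ((∏ᶠ v : HeightOneSpectrum (𝓞 L), max 1 ‖((traceZeroLine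 ↥(maximalRealSubfield L) L (IsCMField.complexConj L) hcδ hδ ((0, b) : AdeleRing (𝓞 ↥(maximalRealSubfield L)) ↥(maximalRealSubfield L)) : traceZeroAdele ↥(maximalRealSubfield L) L (IsCMField.complexConj L)) : AdeleRing (𝓞 L) L).2 v‖₊ : ℝ≥0) : ℝ) ^ (-σ) := by
  have hk : (1 : (quasiSplit (↥(maximalRealSubfield L)) L (IsCMField.complexConj L) 2).Adelic) ∈ ((standardMaximalCompactGL 2 L).comap (adelicVal ↥(maximalRealSubfield L) L (IsCMField.complexConj L) 2 ((StdForm.antidiagonal 2).over L)) :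
      Subgroup (quasiSplit (↥(maximalRealSubfield L)) L (IsCMField.complexConj L) 2).Adelic) := Subgroup.one_mem _
  have h := coe_borelHeight_weylLongU_line_mul_eq_cm_two L hij hN hcδ hδ hk b s
  rw [mul_one] at h
  have hA : (0 : ℝ) ≤ (∏ w : InfinitePlace L, ((1 : ℝ) + (w δ) ^ 2 * (s.1 ⟨w.comap (algebraMap ↥(maximalRealSubfield L) L), K2E1HeightBigCellLineFormulaU2.isReal_comap_maximalRealSubfield L w⟩) ^ 2)) := (archFactor_pos L s).le
  have hF : (0 : ℝ) ≤ ((∏ᶠ v : HeightOneSpectrum (𝓞 L), max 1 ‖((traceZeroLine ↥(maximalRealSubfield L) L (IsCMField.complexConj L) hcδ hδ ((0, b) : AdeleRing (𝓞 ↥(maximalRealSubfield L)) ↥(maximalRealSubfield L)) : traceZeroAdele ↥(maximalRealSubfield L) L (IsCMField.complexConj L)) : AdeleRing (𝓞 L) L).2 v‖₊ : ℝ≥0) : ℝ) := NNReal.coe_nonneg _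
  rw [h, Real.inv_rpow (mul_nonneg hA hF), ← Real.rpow_neg (mul_nonneg hA hF), Real.mul_rpow hA hF]

/-- The same in `ℂ`: `(H(w₀·n(θ(ι⁻¹ s, b)))^σ : ℂ) = (A(s)^{−σ} : ℂ) · (h_f(b)^{−σ} : ℂ)`. [cite: MoeglinWaldspurger1995, II.1.6] -/
theorem coe_borelHeight_weylLongU_line_rpow_eq_cm_two (σ : ℝ) (s : mixedSpace ↥(maximalRealSubfield L)) (b : FiniteAdeleRing (𝓞 ↥(maximalRealSubfield L)) ↥(maximalRealSubfield L)) :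
    (((borelHeight (((quasiSplit (↥(maximalRealSubfield L)) L (IsCMField.complexConj L) 2).toAdelic (weylLongU ((IsCMField.complexConj L : L ≃ₐ[↥(maximalRealSubfield L)] L) : L →+* L) (rfl : ((StdForm.antidiagonal 2).over L) = ((StdForm.antidiagonal 2).over L)))) * ((middleRootUnipotent hij hN (Multiplicative.ofAdd (traceZeroLine ↥(maximalRealSubfield L) L (IsCMField.complexConj L) hcδ hδ (((InfiniteAdeleRing.ringEquiv_mixedSpace ↥(maximalRealSubfield L)).symm s, b) : AdeleRing (𝓞 ↥(maximalRealSubfield L)) ↥(maximalRealSubfield L)))) : ↥(adelicUnipotent (↥(maximalRealSubfield L)) L (IsCMField.complexConj L) 2)) : (quasiSplit (↥(maximalRealSubfield L)) L (IsCMField.complexConj L) 2).Adelic)) : ℝ) ^ σ : ℝ) : ℂ) = (((∏ w : InfinitePlace L, ((1 : ℝ) + (w δ) ^ 2 * (s.1 ⟨w.comap (algebraMap ↥(maximalRealSubfield L) L), K2E1HeightBigCellLineFormulaU2.isReal_comap_maximalRealSubfield L w⟩) ^ 2)) ^ (-σ) : ℝ) : ℂ) * ((((∏ᶠ v : HeightOneSpectrum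 (𝓞 L), max 1 ‖((traceZeroLine ↥(maximalRealSubfield L) L (IsCMField.complexConj L) hcδ hδ ((0, b) : AdeleRing (𝓞 ↥(maximalRealSubfield L)) ↥(maximalRealSubfield L)) : traceZeroAdele ↥(maximalRealSubfield L) L (IsCMField.complexConj L)) : AdeleRing (𝓞 L) L).2 v‖₊ : ℝ≥0) : ℝ) ^ (-σ) : ℝ) : ℂ) := by
  rw [borelHeight_weylLongU_line_rpow_eq_cm_two L hij hN hcδ hδ σ s b, Complex.ofReal_mul]

/-! ## §2 The canonically normalised line integral `ν(𝓕)⁻¹·c_ν(σ) = (μ_E(D_∞)·μ_f(𝒪̂))⁻¹·∫A^{−σ}·∫h_f^{−σ}` -/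

section LineIntegral

variable [MeasurableSpace (quasiSplit (↥(maximalRealSubfield L)) L (IsCMField.complexConj L) 2).Adelic] [BorelSpace (quasiSplit (↥(maximalRealSubfield L)) L (IsCMField.complexConj L) 2).Adelic]
  [MeasurableSpace (FiniteAdeleRing (𝓞 ↥(maximalRealSubfield L)) ↥(maximalRealSubfield L))] [BorelSpace (FiniteAdeleRing (𝓞 ↥(maximalRealSubfield L)) ↥(maximalRealSubfield L))]

omit [IsCMField L] [MeasurableSpace (quasiSplit (↥(maximalRealSubfield L)) L (IsCMField.complexConj L) 2).Adelic] [BorelSpace (quasiSplit (↥(maximalRealSubfield L)) L (IsCMField.complexConj L) 2).Adelic] [MeasurableSpace (FiniteAdeleRing (𝓞 ↥(maximalRealSubfield L)) ↥(maximalRealSubfield L))] [BorelSpace (FiniteAdeleRing (𝓞 ↥(maximalRealSubfield L)) ↥(maximalRealSubfield L))] in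
/-- **The splitting `ψ(s, b) = (ι⁻¹ s, b)` pulls Tate's domain back to a box**: `ψ⁻¹(D_{L⁺}) = D_∞ × 𝒪̂` (★ `adeleFundamentalDomain`, definitional up to `ι(ι⁻¹ s) = s`).
[cite: TateThesis1967, Thm 4.1.3, Lemma 4.1.4] -/
theorem preimage_split_adeleFundamentalDomain :
    (fun p : mixedSpace ↥(maximalRealSubfield L) × FiniteAdeleRing (𝓞 ↥(maximalRealSubfield L)) ↥(maximalRealSubfield L) => (((InfiniteAdeleRing.ringEquiv_mixedSpace ↥(maximalRealSubfield L)).symm p.1, p.2) : AdeleRing (𝓞 ↥(maximalRealSubfield L)) ↥(maximalRealSubfield L))) ⁻¹'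
        adeleFundamentalDomain ↥(maximalRealSubfield L) = (ZSpan.fundamentalDomain (latticeBasis ↥(maximalRealSubfield L))) ×ˢ {b : FiniteAdeleRing (𝓞 ↥(maximalRealSubfield L)) ↥(maximalRealSubfield L) | ∀ v, b v ∈ v.adicCompletionIntegers ↥(maximalRealSubfield L)} := by
  ext p
  change (IsFiniteIntegral ↥(maximalRealSubfield L) ((((InfiniteAdeleRing.ringEquiv_mixedSpace ↥(maximalRealSubfield L)).symm p.1, p.2) : AdeleRing (𝓞 ↥(maximalRealSubfield L)) ↥(maximalRealSubfield L))) ∧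
      (InfiniteAdeleRing.ringEquiv_mixedSpace ↥(maximalRealSubfield L)) ((InfiniteAdeleRing.ringEquiv_mixedSpace ↥(maximalRealSubfield L)).symm p.1) ∈
        ZSpan.fundamentalDomain (latticeBasis ↥(maximalRealSubfield L))) ↔ _
  rw [RingEquiv.apply_symm_apply, and_comm, mem_prod]
  exact Iff.rfl

include hij hN in
/-- **THE CANONICALLY NORMALISED LINE INTEGRAL.**  For EVERY Haar measure `ν` of `N(𝔸)` (`U(J₂)` over the CM pair), EVERY fundamental domain `𝓕` of `N(L⁺)` for `ν`, every pair of
additive Haar measures `μ_E` on `L⁺ ⊗ ℝ` and `μ_f` on `𝔸_{L⁺,f}`, and every real `σ`: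
`ν(𝓕)⁻¹ · ∫_{N(𝔸)} H(w₀ v)^σ dν(v) = (μ_E(D_∞)·μ_f(𝒪̂))⁻¹ · (∫_{L⁺⊗ℝ} A(s)^{−σ} dμ_E) · (∫_{𝔸_{L⁺,f}} h_f(b)^{−σ} dμ_f)` (`D_∞` = Mathlib `ZSpan.fundamentalDomain (latticeBasis L⁺)`,
`𝒪̂ = {b | b_v ∈ 𝒪_v ∀ v}`): ★ `inv_mul_integral_eq_inv_mul_integral_traceZeroLine_two` at `μ_A := ψ_*(μ_E × μ_f)`, Tate's `μ_A(D_{L⁺}) = μ_E(D_∞)·μ_f(𝒪̂)`, §1, and Fubini for a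
product function (`integral_prod_mul`, no integrability hypothesis). [cite: Rogawski1990, Prop. 7.3.1] [cite: TateThesis1967, Thm 4.1.3] [cite: MoeglinWaldspurger1995, II.1.6] -/
theorem inv_measure_mul_integral_borelHeight_rpow_eq_cm_two (ν : Measure ↥(adelicUnipotent (↥(maximalRealSubfield L)) L (IsCMField.complexConj L) 2)) [ν.IsHaarMeasure]
    {𝓕 : Set ↥(adelicUnipotent (↥(maximalRealSubfield L)) L (IsCMField.complexConj L) 2)} (h𝓕 : IsFundamentalDomain ↥(rationalUnipotent (↥(maximalRealSubfield L)) L (IsCMField.complexConj L) 2) 𝓕 ν)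
    (μE : Measure (mixedSpace ↥(maximalRealSubfield L))) [μE.IsAddHaarMeasure] (μf : Measure (FiniteAdeleRing (𝓞 ↥(maximalRealSubfield L)) ↥(maximalRealSubfield L))) [μf.IsAddHaarMeasure] (σ : ℝ) :
    (ν 𝓕).toReal⁻¹ * ∫ v, (borelHeight (((quasiSplit (↥(maximalRealSubfield L)) L (IsCMField.complexConj L) 2).toAdelic (weylLongU ((IsCMField.complexConj L : L ≃ₐ[↥(maximalRealSubfield L)] L) : L →+* L) (rfl : ((StdForm.antidiagonal 2).over L) = ((StdForm.antidiagonal 2).over L)))) * (v : (quasiSplit (↥(maximalRealSubfield L)) L (IsCMField.complexConj L) 2).Adelic)) : ℝ) ^ σ ∂ν =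
      ((μE (ZSpan.fundamentalDomain (latticeBasis ↥(maximalRealSubfield L)))).toReal * (μf {b : FiniteAdeleRing (𝓞 ↥(maximalRealSubfield L)) ↥(maximalRealSubfield L) | ∀ v, b v ∈ v.adicCompletionIntegers ↥(maximalRealSubfield L)}).toReal)⁻¹ *
        ((∫ s, (∏ w : InfinitePlace L, ((1 : ℝ) + (w δ) ^ 2 * (s.1 ⟨w.comap (algebraMap ↥(maximalRealSubfield L) L), K2E1HeightBigCellLineFormulaU2.isReal_comap_maximalRealSubfield L w⟩) ^ 2)) ^ (-σ) ∂μE) * ∫ b, ((∏ᶠ v : HeightOneSpectrum (𝓞 L), max 1 ‖((traceZeroLine ↥(maximalRealSubfield L) L (IsCMField.complexConj L) hcδ hδ ((0, b) : AdeleRing (𝓞 ↥(maximalRealSubfield L)) ↥(maximalRealSubfield L)) : traceZeroAdele ↥(maximalRealSubfield L) L (IsCMField.complexConj L)) : AdeleRing (𝓞 L) L).2 v‖₊ : ℝ≥0) : ℝ) ^ (-σ) ∂μf) := by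
  letI : MeasurableSpace (AdeleRing (𝓞 L) L) := borel _
  haveI : BorelSpace (AdeleRing (𝓞 L) L) := ⟨rfl⟩
  letI : MeasurableSpace (AdeleRing (𝓞 ↥(maximalRealSubfield L)) ↥(maximalRealSubfield L)) := borel _
  haveI : BorelSpace (AdeleRing (𝓞 ↥(maximalRealSubfield L)) ↥(maximalRealSubfield L)) := ⟨rfl⟩
  haveI := locallyCompactSpace_adeleRing' L
  haveI := locallyCompactSpace_adelicUnipotent_two (F := ↥(maximalRealSubfield L)) (E := L) (c := IsCMField.complexConj L)
  haveI : SecondCountableTopology (FiniteAdeleRing (𝓞 ↥(maximalRealSubfield L)) ↥(maximalRealSubfield L)) := secondCountableTopology_finiteAdeleRing ↥(maximalRealSubfield L)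
  haveI : LocallyCompactSpace (FiniteAdeleRing (𝓞 ↥(maximalRealSubfield L)) ↥(maximalRealSubfield L)) := locallyCompactSpace_finiteAdeleRing' ↥(maximalRealSubfield L)
  haveI : BorelSpace (mixedSpace ↥(maximalRealSubfield L) × FiniteAdeleRing (𝓞 ↥(maximalRealSubfield L)) ↥(maximalRealSubfield L)) := Prod.borelSpace
  haveI : (μE.prod μf).IsAddHaarMeasure := Measure.prod.instIsAddHaarMeasure μE μf
  have hc : IsCMField.complexConj L * IsCMField.complexConj L = 1 := AlgEquiv.ext fun x => IsCMField.complexConj_apply_apply L x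
  -- the splitting `ψ(s, b) = (ι⁻¹ s, b)` as a homeomorphism and as a continuous additive equivalence onto `𝔸_{L⁺}`
  let ψh : mixedSpace ↥(maximalRealSubfield L) × FiniteAdeleRing (𝓞 ↥(maximalRealSubfield L)) ↥(maximalRealSubfield L) ≃ₜ AdeleRing (𝓞 ↥(maximalRealSubfield L)) ↥(maximalRealSubfield L) :=
    (infiniteAdeleRingHomeomorph ↥(maximalRealSubfield L)).symm.prodCongr (Homeomorph.refl _)
  let ψA : mixedSpace ↥(maximalRealSubfield L) × FiniteAdeleRing (𝓞 ↥(maximalRealSubfield L)) ↥(maximalRealSubfield L) ≃ₜ+ AdeleRing (𝓞 ↥(maximalRealSubfield L)) ↥(maximalRealSubfield L) :=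
    ContinuousAddEquiv.mk' ψh fun x y => Prod.ext (map_add (InfiniteAdeleRing.ringEquiv_mixedSpace ↥(maximalRealSubfield L)).symm x.1 y.1) rfl
  haveI hμA : ((μE.prod μf).map ψh).IsAddHaarMeasure := ContinuousAddEquiv.isAddHaarMeasure_map (μE.prod μf) ψA
  -- Tate: `μ_A(D_{L⁺}) = μ_E(D_∞)·μ_f(𝒪̂)`
  have hpre : ⇑ψh ⁻¹' adeleFundamentalDomain ↥(maximalRealSubfield L) = (ZSpan.fundamentalDomain (latticeBasis ↥(maximalRealSubfield L))) ×ˢ {b : FiniteAdeleRing (𝓞 ↥(maximalRealSubfield L)) ↥(maximalRealSubfield L) | ∀ v, b v ∈ v.adicCompletionIntegers ↥(maximalRealSubfield L)} :=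
    preimage_split_adeleFundamentalDomain L
  have hD : ((μE.prod μf).map ψh) (adeleFundamentalDomain ↥(maximalRealSubfield L)) = μE (ZSpan.fundamentalDomain (latticeBasis ↥(maximalRealSubfield L))) * μf {b : FiniteAdeleRing (𝓞 ↥(maximalRealSubfield L)) ↥(maximalRealSubfield L) | ∀ v, b v ∈ v.adicCompletionIntegers ↥(maximalRealSubfield L)} := by
    rw [Measure.map_apply ψh.measurable (measurableSet_adeleFundamentalDomain _), hpre, Measure.prod_prod]
  -- ★ the `𝔸_F`-reading at `μ_A := ψ_*(μ_E × μ_f)`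
  have key := inv_mul_integral_eq_inv_mul_integral_traceZeroLine_two hij hN hcδ hδ hc ((μE.prod μf).map ψh) ν h𝓕
    (fun v => (((borelHeight (((quasiSplit (↥(maximalRealSubfield L)) L (IsCMField.complexConj L) 2).toAdelic (weylLongU ((IsCMField.complexConj L : L ≃ₐ[↥(maximalRealSubfield L)] L) : L →+* L) (rfl : ((StdForm.antidiagonal 2).over L) = ((StdForm.antidiagonal 2).over L)))) * (v : (quasiSplit (↥(maximalRealSubfield L)) L (IsCMField.complexConj L) 2).Adelic)) : ℝ) ^ σ : ℝ) : ℂ))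
  rw [ψh.measurableEmbedding.integral_map, hD] at key
  -- §1 under the integral, then Fubini for a product function
  have hint : ∫ p : mixedSpace ↥(maximalRealSubfield L) × FiniteAdeleRing (𝓞 ↥(maximalRealSubfield L)) ↥(maximalRealSubfield L),
      (((borelHeight (((quasiSplit (↥(maximalRealSubfield L)) L (IsCMField.complexConj L) 2).toAdelic (weylLongU ((IsCMField.complexConj L : L ≃ₐ[↥(maximalRealSubfield L)] L) : L →+* L) (rfl : ((StdForm.antidiagonal 2).over L) = ((StdForm.antidiagonal 2).over L)))) * ((middleRootUnipotent hij hN (Multiplicative.ofAdd (traceZeroLine ↥(maximalRealSubfield L) L (IsCMField.complexConj L) hcδ hδ (ψh p))) : ↥(adelicUnipotent (↥(maximalRealSubfield L)) L (IsCMField.complexConj L) 2)) : (quasiSplit (↥(maximalRealSubfield L)) L (IsCMField.complexConj L) 2).Adelic)) : ℝ) ^ σ : ℝ) : ℂ) ∂(μE.prod μf) =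
      (∫ s, (((∏ w : InfinitePlace L, ((1 : ℝ) + (w δ) ^ 2 * (s.1 ⟨w.comap (algebraMap ↥(maximalRealSubfield L) L), K2E1HeightBigCellLineFormulaU2.isReal_comap_maximalRealSubfield L w⟩) ^ 2)) ^ (-σ) : ℝ) : ℂ) ∂μE) * ∫ b, ((((∏ᶠ v : HeightOneSpectrum (𝓞 L), max 1 ‖((traceZeroLine ↥(maximalRealSubfield L) L (IsCMField.complexConj L) hcδ hδ ((0, b) : AdeleRing (𝓞 ↥(maximalRealSubfield L)) ↥(maximalRealSubfield L)) : traceZeroAdele ↥(maximalRealSubfield L) L (IsCMField.complexConj L)) : AdeleRing (𝓞 L) L).2 v‖₊ : ℝ≥0) : ℝ) ^ (-σ) : ℝ) : ℂ) ∂μf := by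
    rw [← integral_prod_mul]
    refine integral_congr_ae (Eventually.of_forall fun p => ?_)
    exact coe_borelHeight_weylLongU_line_rpow_eq_cm_two L hij hN hcδ hδ σ p.1 p.2
  rw [hint, integral_complex_ofReal, integral_complex_ofReal, integral_complex_ofReal, ENNReal.toReal_mul] at key
  exact_mod_cast key

end LineIntegral

/-! ## §3 Integrability for `σ > 1`: `A^{−σ}·h_f^{−σ} ∈ L¹(μ_E × μ_f)`, `h_f^{−σ} ∈ L¹(μ_f)`, `A^{−σ} ∈ L¹(μ_E)` -/

section Integrability

variable [MeasurableSpace (quasiSplit (↥(maximalRealSubfield L)) L (IsCMField.complexConj L) 2).Adelic] [BorelSpace (quasiSplit (↥(maximalRealSubfield L)) L (IsCMField.complexConj L) 2).Adelic]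

include hij hN in
/-- **The product integrand `A(s)^{−σ}·h_f(b)^{−σ}` is `μ_E × μ_f`-integrable for `σ > 1`** — Godement finiteness at CM (★ `integrable_borelHeight_weylLongU_mul_rpow_cm_two` at `g = 1`)
for the transported Haar measure `Φ_*(μ_E × μ_f)` on `N(𝔸)` (its binders discharged by ★ `isInvInvariant_of_isHaarMeasure_two`, the transported Tate domain `n(𝓕⁻)` ★ and its compact
closure ★), pulled back along the homeomorphism `Φ`. [cite: MoeglinWaldspurger1995, II.1.6] [cite: Godement1964, §1.1] -/
theorem integrable_archFactor_mul_finFactor_rpow_neg_cm_two [MeasurableSpace (FiniteAdeleRing (𝓞 ↥(maximalRealSubfield L)) ↥(maximalRealSubfield L))] [BorelSpace (FiniteAdeleRing (𝓞 ↥(maximalRealSubfield L)) ↥(maximalRealSubfield L))]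
    (μE : Measure (mixedSpace ↥(maximalRealSubfield L))) [μE.IsAddHaarMeasure] (μf : Measure (FiniteAdeleRing (𝓞 ↥(maximalRealSubfield L)) ↥(maximalRealSubfield L))) [μf.IsAddHaarMeasure] {σ : ℝ} (hσ : 1 < σ) :
    Integrable (fun p : mixedSpace ↥(maximalRealSubfield L) × FiniteAdeleRing (𝓞 ↥(maximalRealSubfield L)) ↥(maximalRealSubfield L) => (∏ w : InfinitePlace L, ((1 : ℝ) + (w δ) ^ 2 * (p.1.1 ⟨w.comap (algebraMap ↥(maximalRealSubfield L) L), K2E1HeightBigCellLineFormulaU2.isReal_comap_maximalRealSubfield L w⟩) ^ 2)) ^ (-σ) * ((∏ᶠ v : HeightOneSpectrum (𝓞 L), max 1 ‖((traceZeroLine ↥(maximalRealSubfield L) L (IsCMField.complexConj L) hcδ hδ ((0, p.2) : AdeleRing (𝓞 ↥(maximalRealSubfield L)) ↥(maximalRealSubfield L)) : traceZeroAdele ↥(maximalRealSubfield L) L (IsCMField.complexConj L)) : AdeleRing (𝓞 L) L).2 v‖₊ : ℝ≥0) : ℝ) ^ (-σ)) (μE.prod μf) := by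
  letI : MeasurableSpace (AdeleRing (𝓞 L) L) := borel _
  haveI : BorelSpace (AdeleRing (𝓞 L) L) := ⟨rfl⟩
  letI : MeasurableSpace (AdeleRing (𝓞 ↥(maximalRealSubfield L)) ↥(maximalRealSubfield L)) := borel _
  haveI : BorelSpace (AdeleRing (𝓞 ↥(maximalRealSubfield L)) ↥(maximalRealSubfield L)) := ⟨rfl⟩
  haveI := locallyCompactSpace_adeleRing' L
  haveI := locallyCompactSpace_adelicUnipotent_two (F := ↥(maximalRealSubfield L)) (E := L) (c := IsCMField.complexConj L)
  haveI : SecondCountableTopology (FiniteAdeleRing (𝓞 ↥(maximalRealSubfield L)) ↥(maximalRealSubfield L)) := secondCountableTopology_finiteAdeleRing ↥(maximalRealSubfield L)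
  haveI : LocallyCompactSpace (FiniteAdeleRing (𝓞 ↥(maximalRealSubfield L)) ↥(maximalRealSubfield L)) := locallyCompactSpace_finiteAdeleRing' ↥(maximalRealSubfield L)
  haveI : BorelSpace (mixedSpace ↥(maximalRealSubfield L) × FiniteAdeleRing (𝓞 ↥(maximalRealSubfield L)) ↥(maximalRealSubfield L)) := Prod.borelSpace
  haveI : (μE.prod μf).IsAddHaarMeasure := Measure.prod.instIsAddHaarMeasure μE μf
  have hc : IsCMField.complexConj L * IsCMField.complexConj L = 1 := AlgEquiv.ext fun x => IsCMField.complexConj_apply_apply L x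
  -- the splitting `ψ(s, b) = (ι⁻¹ s, b)` as a homeomorphism and as a continuous additive equivalence onto `𝔸_{L⁺}`
  let ψh : mixedSpace ↥(maximalRealSubfield L) × FiniteAdeleRing (𝓞 ↥(maximalRealSubfield L)) ↥(maximalRealSubfield L) ≃ₜ AdeleRing (𝓞 ↥(maximalRealSubfield L)) ↥(maximalRealSubfield L) :=
    (infiniteAdeleRingHomeomorph ↥(maximalRealSubfield L)).symm.prodCongr (Homeomorph.refl _)
  let ψA : mixedSpace ↥(maximalRealSubfield L) × FiniteAdeleRing (𝓞 ↥(maximalRealSubfield L)) ↥(maximalRealSubfield L) ≃ₜ+ AdeleRing (𝓞 ↥(maximalRealSubfield L)) ↥(maximalRealSubfield L) :=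
    ContinuousAddEquiv.mk' ψh fun x y => Prod.ext (map_add (InfiniteAdeleRing.ringEquiv_mixedSpace ↥(maximalRealSubfield L)).symm x.1 y.1) rfl
  -- `Φ = n ∘ θ ∘ ψ : (L⁺ ⊗ ℝ) × 𝔸_{L⁺,f} ≃ₜ N(𝔸)`; `θ ∘ ψ` as a continuous additive equivalence onto `𝔸_L⁻`
  let θA : mixedSpace ↥(maximalRealSubfield L) × FiniteAdeleRing (𝓞 ↥(maximalRealSubfield L)) ↥(maximalRealSubfield L) ≃ₜ+ ↥(traceZeroAdele ↥(maximalRealSubfield L) L (IsCMField.complexConj L)) := ψA.trans (traceZeroLine ↥(maximalRealSubfield L) L (IsCMField.complexConj L) hcδ hδ)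
  let nh : ↥(traceZeroAdele ↥(maximalRealSubfield L) L (IsCMField.complexConj L)) ≃ₜ ↥(adelicUnipotent (↥(maximalRealSubfield L)) L (IsCMField.complexConj L) 2) :=
    (isHomeomorph_middleRootUnipotent_two (F := ↥(maximalRealSubfield L)) (E := L) (c := IsCMField.complexConj L) hij hN).homeomorph _
  let Φh : mixedSpace ↥(maximalRealSubfield L) × FiniteAdeleRing (𝓞 ↥(maximalRealSubfield L)) ↥(maximalRealSubfield L) ≃ₜ ↥(adelicUnipotent (↥(maximalRealSubfield L)) L (IsCMField.complexConj L) 2) := θA.toHomeomorph.trans nh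
  -- the transported Haar measure and its Godement binders
  set μY : Measure ↥(traceZeroAdele ↥(maximalRealSubfield L) L (IsCMField.complexConj L)) := (μE.prod μf).map θA with hμY
  haveI : μY.IsAddHaarMeasure := ContinuousAddEquiv.isAddHaarMeasure_map (μE.prod μf) θA
  set ν : Measure ↥(adelicUnipotent (↥(maximalRealSubfield L)) L (IsCMField.complexConj L) 2) := μY.map fun b => middleRootUnipotent hij hN (Multiplicative.ofAdd b) with hν
  haveI : ν.IsHaarMeasure := isHaarMeasure_map_middleRootUnipotent_two hij hN μY
  haveI : ν.IsInvInvariant := isInvInvariant_of_isHaarMeasure_two ν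
  obtain ⟨C, hC, hsub⟩ := exists_isCompact_image_traceZeroFundamentalDomain_subset_two (F := ↥(maximalRealSubfield L)) (E := L) (c := IsCMField.complexConj L) hij hN hc
  have hG := integrable_borelHeight_weylLongU_mul_rpow_cm_two L ν (isFundamentalDomain_image_traceZeroFundamentalDomain_two hij hN hc ν) (hC.closure_of_subset hsub) hσ 1
  simp_rw [mul_one] at hG
  -- pull back along `Φ`
  have hνΦ : ν = (μE.prod μf).map Φh := by
    rw [hν, hμY, Measure.map_map (measurableEmbedding_middleRootUnipotent_two hij hN).measurable (show Measurable (⇑θA) from θA.continuous.measurable)]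
    rfl
  rw [hνΦ, Φh.measurableEmbedding.integrable_map_iff] at hG
  refine hG.congr (Eventually.of_forall fun p => ?_)
  exact borelHeight_weylLongU_line_rpow_eq_cm_two L hij hN hcδ hδ σ p.1 p.2

include hij hN in
/-- **`h_f^{−σ} ∈ L¹(μ_f)` for `σ > 1`**: the finite height factor along the line is integrable on `𝔸_{L⁺,f}` (Fubini slice of the previous theorem at one archimedean point; `A(s)^{−σ} ≠ 0`).
This is the integrability hypothesis of ★ `AdelicProductIntegralOne.hasProd_localIntegral_of_integrable_one` for FILE 3's Euler product. [cite: MoeglinWaldspurger1995, II.1.6] [cite: TateThesis1967, Thm 3.3.1] -/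
theorem integrable_finFactor_rpow_neg_cm_two [MeasurableSpace (FiniteAdeleRing (𝓞 ↥(maximalRealSubfield L)) ↥(maximalRealSubfield L))] [BorelSpace (FiniteAdeleRing (𝓞 ↥(maximalRealSubfield L)) ↥(maximalRealSubfield L))]
    (μf : Measure (FiniteAdeleRing (𝓞 ↥(maximalRealSubfield L)) ↥(maximalRealSubfield L))) [μf.IsAddHaarMeasure] {σ : ℝ} (hσ : 1 < σ) :
    Integrable (fun b : FiniteAdeleRing (𝓞 ↥(maximalRealSubfield L)) ↥(maximalRealSubfield L) => ((∏ᶠ v : HeightOneSpectrum (𝓞 L), max 1 ‖((traceZeroLine ↥(maximalRealSubfield L) L (IsCMField.complexConj L) hcδ hδ ((0, b) : AdeleRing (𝓞 ↥(maximalRealSubfield L)) ↥(maximalRealSubfield L)) : traceZeroAdele ↥(maximalRealSubfield L) L (IsCMField.complexConj L)) : AdeleRing (𝓞 L) L).2 v‖₊ : ℝ≥0) : ℝ) ^ (-σ)) μf := by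
  haveI : SecondCountableTopology (FiniteAdeleRing (𝓞 ↥(maximalRealSubfield L)) ↥(maximalRealSubfield L)) := secondCountableTopology_finiteAdeleRing ↥(maximalRealSubfield L)
  haveI : LocallyCompactSpace (FiniteAdeleRing (𝓞 ↥(maximalRealSubfield L)) ↥(maximalRealSubfield L)) := locallyCompactSpace_finiteAdeleRing' ↥(maximalRealSubfield L)
  have h := integrable_archFactor_mul_finFactor_rpow_neg_cm_two L hij hN hcδ hδ (Measure.addHaar : Measure (mixedSpace ↥(maximalRealSubfield L))) μf hσ
  have h1 := ((integrable_prod_iff h.aestronglyMeasurable).1 h).1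
  obtain ⟨s, hs⟩ := h1.exists
  have hA : IsUnit ((∏ w : InfinitePlace L, ((1 : ℝ) + (w δ) ^ 2 * (s.1 ⟨w.comap (algebraMap ↥(maximalRealSubfield L) L), K2E1HeightBigCellLineFormulaU2.isReal_comap_maximalRealSubfield L w⟩) ^ 2)) ^ (-σ)) := isUnit_iff_ne_zero.2 (Real.rpow_pos_of_pos (archFactor_pos L s) _).ne'
  exact (integrable_const_mul_iff hA _).1 hs

include hij hN hcδ hδ in
/-- **`A^{−σ} ∈ L¹(μ_E)` for `σ > 1`**: the archimedean factor `c_∞(σ) = ∫_{L⁺⊗ℝ} A(s)^{−σ} dμ_E` converges (Fubini slice the other way; `∫ h_f^{−σ} dμ_f > 0`).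
[cite: MoeglinWaldspurger1995, II.1.6] -/
theorem integrable_archFactor_rpow_neg_cm_two (μE : Measure (mixedSpace ↥(maximalRealSubfield L))) [μE.IsAddHaarMeasure] {σ : ℝ} (hσ : 1 < σ) :
    Integrable (fun s : mixedSpace ↥(maximalRealSubfield L) => (∏ w : InfinitePlace L, ((1 : ℝ) + (w δ) ^ 2 * (s.1 ⟨w.comap (algebraMap ↥(maximalRealSubfield L) L), K2E1HeightBigCellLineFormulaU2.isReal_comap_maximalRealSubfield L w⟩) ^ 2)) ^ (-σ)) μE := by
  letI : MeasurableSpace (FiniteAdeleRing (𝓞 ↥(maximalRealSubfield L)) ↥(maximalRealSubfield L)) := borel _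
  haveI : BorelSpace (FiniteAdeleRing (𝓞 ↥(maximalRealSubfield L)) ↥(maximalRealSubfield L)) := ⟨rfl⟩
  haveI : SecondCountableTopology (FiniteAdeleRing (𝓞 ↥(maximalRealSubfield L)) ↥(maximalRealSubfield L)) := secondCountableTopology_finiteAdeleRing ↥(maximalRealSubfield L)
  haveI : LocallyCompactSpace (FiniteAdeleRing (𝓞 ↥(maximalRealSubfield L)) ↥(maximalRealSubfield L)) := locallyCompactSpace_finiteAdeleRing' ↥(maximalRealSubfield L)
  set μf : Measure (FiniteAdeleRing (𝓞 ↥(maximalRealSubfield L)) ↥(maximalRealSubfield L)) := Measure.addHaar with hμf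
  have h := integrable_archFactor_mul_finFactor_rpow_neg_cm_two L hij hN hcδ hδ μE μf hσ
  have h2 := ((integrable_prod_iff h.aestronglyMeasurable).1 h).2
  have hfin := integrable_finFactor_rpow_neg_cm_two L hij hN hcδ hδ μf hσ
  have hpos : ∀ b : FiniteAdeleRing (𝓞 ↥(maximalRealSubfield L)) ↥(maximalRealSubfield L), 0 < ((∏ᶠ v : HeightOneSpectrum (𝓞 L), max 1 ‖((traceZeroLine ↥(maximalRealSubfield L) L (IsCMField.complexConj L) hcδ hδ ((0, b) : AdeleRing (𝓞 ↥(maximalRealSubfield L)) ↥(maximalRealSubfield L)) : traceZeroAdele ↥(maximalRealSubfield L) L (IsCMField.complexConj L)) : AdeleRing (𝓞 L) L).2 v‖₊ : ℝ≥0) : ℝ) ^ (-σ) := fun b =>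
    Real.rpow_pos_of_pos (lt_of_lt_of_le one_pos (one_le_coe_finprod_line_cm_two L hcδ hδ b)) _
  have hI : 0 < ∫ b, ((∏ᶠ v : HeightOneSpectrum (𝓞 L), max 1 ‖((traceZeroLine ↥(maximalRealSubfield L) L (IsCMField.complexConj L) hcδ hδ ((0, b) : AdeleRing (𝓞 ↥(maximalRealSubfield L)) ↥(maximalRealSubfield L)) : traceZeroAdele ↥(maximalRealSubfield L) L (IsCMField.complexConj L)) : AdeleRing (𝓞 L) L).2 v‖₊ : ℝ≥0) : ℝ) ^ (-σ) ∂μf := by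
    rw [integral_pos_iff_support_of_nonneg (fun b => (hpos b).le) hfin]
    have hsupp : (Function.support fun b : FiniteAdeleRing (𝓞 ↥(maximalRealSubfield L)) ↥(maximalRealSubfield L) => ((∏ᶠ v : HeightOneSpectrum (𝓞 L), max 1 ‖((traceZeroLine ↥(maximalRealSubfield L) L (IsCMField.complexConj L) hcδ hδ ((0, b) : AdeleRing (𝓞 ↥(maximalRealSubfield L)) ↥(maximalRealSubfield L)) : traceZeroAdele ↥(maximalRealSubfield L) L (IsCMField.complexConj L)) : AdeleRing (𝓞 L) L).2 v‖₊ : ℝ≥0) : ℝ) ^ (-σ)) = univ := eq_univ_of_forall fun b => (hpos b).ne'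
    rw [hsupp]
    exact measure_univ_pos.2 (NeZero.ne μf)
  have h3 : Integrable (fun s : mixedSpace ↥(maximalRealSubfield L) => (∏ w : InfinitePlace L, ((1 : ℝ) + (w δ) ^ 2 * (s.1 ⟨w.comap (algebraMap ↥(maximalRealSubfield L) L), K2E1HeightBigCellLineFormulaU2.isReal_comap_maximalRealSubfield L w⟩) ^ 2)) ^ (-σ) * ∫ b, ((∏ᶠ v : HeightOneSpectrum (𝓞 L), max 1 ‖((traceZeroLine ↥(maximalRealSubfield L) L (IsCMField.complexConj L) hcδ hδ ((0, b) : AdeleRing (𝓞 ↥(maximalRealSubfield L)) ↥(maximalRealSubfield L)) : traceZeroAdele ↥(maximalRealSubfield L) L (IsCMField.complexConj L)) : AdeleRing (𝓞 L) L).2 v‖₊ : ℝ≥0) : ℝ) ^ (-σ) ∂μf) μE := by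
    refine h2.congr (Eventually.of_forall fun s => ?_)
    simp only
    rw [← integral_const_mul]
    exact integral_congr_ae (Eventually.of_forall fun b => Real.norm_of_nonneg (mul_nonneg (Real.rpow_nonneg (archFactor_pos L s).le _) (hpos b).le))
  exact (integrable_mul_const_iff (isUnit_iff_ne_zero.2 hI.ne') _).1 h3

end Integrability

end Summit.HodgeConjecture.HodgeConjecture.Cruxes.H413.K2E1IntertwiningScalarLineIntegralU2

end
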